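import Literature.MathematicalPhysics.QuantumFieldTheory.Balaban1983to89.B9Eq316AveragingTransposeZdLinear
import Literature.MathematicalPhysics.QuantumFieldTheory.Balaban1983to89.B9Eq332FieldAvgCovariance

/-!
# `Balaban1983to89.B9Eq332AveragingLetterCovarianceZd` — [Balaban1985BackgroundPropagators] (3.32) second clause p. 395 ∕ «the equalities (3.32) hold again»
# p. 396 AT THE `ℤᵈ × 𝔸` CARRIER: dag-n06-b's GENUINE AVERAGING LETTER `Q*aQ` of (3.16), EDITION P (`QQZdP τ L ΛbP i m`), IS GAUGE COVARIANT —
# `(Q*aQ)(U₀^u)(R(u)A) = R(u)((Q*aQ)(U₀)A)` for unitary `U₀`, unitary `u`, on print's class (box law of the averaging class)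

statement-level skeleton of published theorems with citation tags; proofs where landed; nothing here is a claim about the
Yang–Mills mass gap

T. Bałaban, *Propagators for lattice gauge theories in a background field*, Commun. Math. Phys. **99** (1985) 389–434 [`Balaban1985BackgroundPropagators`,
"B9"], journal page = PDF page + 388; [5] = T. Bałaban, *Averaging operations for lattice gauge theories*, Commun. Math. Phys. **98** (1985) 17–51
[`Balaban1985Averaging`].  THE PRINT (verbatim).  p. 395: *«(Q′_j(U^u)R(u)λ)(y) = R(u(y))(Q′_j(U)λ)(y), (3.32) and Q′\*(U^u)aQ′(U^u) = R(u)Q′\*(U)aQ′(U)R(u⁻¹)»*;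
p. 396: *«Finally inspecting the definitions of the averaging operators Q_j(U) for gauge fields we can see that the equalities (3.32) hold again. This implies
the transformation laws for the operators Δ_a and G»* (3.34); [5] (11) p. 19 (gauge covariance of the averaging operation), (127) p. 37, (141)–(147) pp.
39–40 (the linear averaging `Q(V₀)` is defined and linear for REGULAR `V₀`).

CITATION HEADER ∕ WHY THIS FILE (cell `pub-ymgap`, HUMAN RULING D-0062 ∕ D-0149; width seat `pub-ymgap-dag-n06-w3` (g3), node N06 = [B9]; CLAIM-2 FILE C).
The companions `B9Eq333ProjectionCovarianceZd` ∕ `B9Eq334GaugeCovarianceZd` prove (3.32)–(3.34) for the junction's `Q′_j ∕ R(U₀) ∕ Δ_a ∕ G(U₀)` with the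
covariance of the `Q*aQ` LETTER displayed.  THIS FILE discharges it for dag-n06-b's genuine letter (`B9Eq316AveragingTransposeZdPrinted.QQZdP`:
`(Q*aQ A)(b) = Σ_{j≤m} w_j·(Q_jᵀ(𝟙_{Λ_j}·(−i)LʲηQ_j(U₀)(iηA)))(b)` on the class (1.7) at window `α_Q∕L²`, `0` off it), from: the class (1.7) is an ORBIT
condition (`plaqF_gaugeAct`, `norm_conjR`); the field averages are covariant with the level gauge `u_j` (`B9Eq332FieldAvgCovariance.linCovIter_rot`,
UNCONDITIONAL); and the `τ`-transpose `entryT` of a REAL-LINEAR column map conjugates — `(R(g)∘E∘R(h)⁻¹)ᵀ(R(g)v) = R(h)(Eᵀv)` by the characterisation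
`⟨Eᵀv, X⟩_τ = ⟨v, EX⟩_τ` (`tauForm_entryT`) and the `R`-invariance of `⟨·,·⟩_τ` for a tracial `τ` — where the column maps `X ↦ LʲQ_j(U₀)(X·δ_b)(c)` ARE
real-linear in print's regime ([5] (122); dag-n06-b's `linCovIter_add_of_reg17 ∕ linCovIter_smul_of_reg17` under the BOX clause of the class bonds).

WHAT IS PROVED (theorems only, 0 definitions; no `instance`, no `notation`; kernel, 0 sorry).  `τ` tracial and faithful-positive on a finite-dimensional fibre,
`u : ℤᵈ → 𝔸ˣ` unitary-valued, `U₀` unitary-valued where the regime is used, `2 ≤ L`.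
* §1 fibre: `tauForm_conjR` (`⟨R(g)a, R(g)b⟩_τ = ⟨a, b⟩_τ`), ★ `entryT_conj` (the transpose of `R(g)∘E∘R(h⁻¹)` at `R(g)v` is `R(h)(Eᵀv)`, `E` real-linear),
  `entryT_zero'`.
* §2 the class: ★ `reg17_gaugeAct_iff` (`Reg17 … (U₀^u) ↔ Reg17 … U₀`, `u` in `U1`).
* §3 letters: `bump_conjR` (`R(u)(X·δ_b) = (R(u(b₋))X)·δ_b`), `iEta_conjR`, ★ `clsField_gaugeAct` (`𝟙_{Λ_j}(−i)LʲηQ_j(U₀^u)(iηR(u)A) = R(u_j)(…)(A)`, EVERY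
  `u`, EVERY `U₀` — from `linCovIter_rot`).
* §4 ★★ `linCovIterT_gaugeAct` — the transpose `Q_jᵀ` is covariant on inputs supported on bonds whose box lies in the regularity domain: `(Q_j(U₀^u)ᵀ(R(u_j)B))(b)
  = R(u(b₋))((Q_j(U₀)ᵀB)(b))` (regime (1.7) at `α_Q`, unitary `U₀`).
* §5 `QQZdP_gaugeAct_core` · ★★★ `QQZdP_gaugeAct` — `QQZdP τ L ΛbP i m (gaugeAct u U₀) (fun z κ => conjR (u z) (A z κ)) = fun y μ => conjR (u y) (QQZdP τ L
  ΛbP i m U₀ A y μ)` for EVERY field `A`, unitary `U₀`, unitary `u`, `2 ≤ L`, under the class's BOX clause «box of a level-j class bond ⊂ Ω_{j−1}» (the same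
  clause as dag-n06-b's `QQZdP_add`) · `reg17_of_univ` · ★★ `QQZdP_gaugeAct_of_reg17Univ` (NO box clause: `U₀` in the class (1.7) on `Ω ≡ ℤᵈ` at window
  `α_Q∕L²` — dag-n06-w2 g3's regime set for the per-member Theorem-3.11 road).

HONEST SCOPE.  Conjugation algebra on dag-n06-b's landed letter; the regime hypotheses are print's (the averaging is defined for regular backgrounds); no
estimate of [B9]; count-neutral; N05 ∕ N06 NOT discharged; K1⁷ `stmt-QuantumFields-20542` NOT closed; one finite `𝕋⁴` programme at fixed `ε`, Bałaban as
printed; R4 closes only the conditional finite-`𝕋⁴` rung `BalabanLadder.UV` — nothing continuum ∕ ℝ⁴ ∕ OS ∕ mass gap ∕ Clay.  Unit `pub-ymgap-dag-n06-w3` (g3),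
2026-08-28.
-/

noncomputable section

namespace Literature.MathematicalPhysics.QuantumFieldTheory.Balaban1983to89.B9Eq332AveragingLetterCovarianceZd

open B7Prop1Explicit B7Eq78Linearization
open B7Prop1Local (InBox loK bondHiK)
open B7Prop2Explicit (unitaryUnits unitaryUnits_le_U1)
open B7AvgGaugeCovariance (uLev uLev_zero)
open B7Prop5Flat (bump)
open B7Prop4GeneralLevels (linCovIter)
open B8Ineq132 (plaqF conjR_conjR one_conjR conjR_sum norm_conjR plaqF_gaugeAct)
open B8Eq146AExpansion (iEta)
open B8LeafModelZd (ZdIdx)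
open B9Eq332FieldAvgCovariance (linCovIter_rot)
open B9Eq332AvgCovariance (conjR_inv_conjR)
open B9Eq316AveragingTransposeZd B9Eq316AveragingTransposeZdPrinted B9Eq316AveragingTransposeZdLinear

-- `Site` alone could resolve to the torus sites of `Setup.lean`; re-export the `ℤ^d` sites of `B7Prop1Explicit`.
export B7Prop1Explicit (Site)

variable {d : ℕ} {𝔸 : Type*} [CStarAlgebra 𝔸]

/-! ## §1  The fibre: `⟨·,·⟩_τ` is `R(g)`-invariant; the `τ`-transpose of a conjugated real-linear map -/

section Fibre

variable (τ : 𝔸 →ₗ[ℂ] ℂ)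

omit [CStarAlgebra 𝔸] in
/-- `(R(v)a)* = R(v)(a*)` for a UNITARY `v`. [cite: Balaban1985RegularSpaces, (1.1) p.76 (the transporters are unitary)] -/
private theorem star_conjR_unitary {𝔸 : Type*} [NormedRing 𝔸] [StarRing 𝔸] [NormedAlgebra ℂ 𝔸] {v : 𝔸ˣ} (hv : v ∈ unitaryUnits 𝔸) (a : 𝔸) :
    star (conjR v a) = conjR v (star a) := by
  have hv' : (v : 𝔸) ∈ unitary 𝔸 := hv
  have hinv : ((v⁻¹ : 𝔸ˣ) : 𝔸) = star (v : 𝔸) := Units.inv_eq_of_mul_eq_one_right (Unitary.mul_star_self_of_mem hv')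
  rw [conjR_apply, conjR_apply, hinv, star_mul, star_mul, star_star, mul_assoc]

/-- `R(v)(ab) = R(v)a·R(v)b`. [folklore] -/
private theorem conjR_mul'' (v : 𝔸ˣ) (a b : 𝔸) : conjR v (a * b) = conjR v a * conjR v b := by
  simp only [conjR_apply, mul_assoc, Units.inv_mul_cancel_left]

/-- **`⟨R(g)a, R(g)b⟩_τ = ⟨a, b⟩_τ`** for unitary `g` and tracial `τ` (the fibre pairing «X·Y = tr XY» is `Ad`-invariant).
[cite: Balaban1985BackgroundPropagators, (3.30) p.395, p.391 («X·Y = tr XY»)] -/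
theorem tauForm_conjR (hτt : ∀ a b : 𝔸, τ (a * b) = τ (b * a)) {g : 𝔸ˣ} (hg : g ∈ unitaryUnits 𝔸) (a b : 𝔸) :
    tauForm τ (conjR g a) (conjR g b) = tauForm τ a b := by
  rw [tauForm_apply, tauForm_apply, star_conjR_unitary hg, ← conjR_mul'', conjR_apply, hτt, ← mul_assoc, Units.inv_mul, one_mul]

variable [FiniteDimensional ℝ 𝔸]

/-- `Eᵀ0 = 0` (for EVERY map `E`). [cite: Balaban1985BackgroundPropagators, (3.16) p.393 (bookkeeping)] -/
theorem entryT_zero' (E : 𝔸 → 𝔸) : entryT τ E 0 = 0 := by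
  have h := entryT_smul τ E 0 0
  rwa [zero_smul, zero_smul] at h

/-- ★ **THE `τ`-TRANSPOSE OF A CONJUGATED REAL-LINEAR MAP**: for a real-linear `E`, unitary `g, h` and tracial faithful `τ`,
`(R(g)∘E∘R(h⁻¹))ᵀ(R(g)v) = R(h)(Eᵀv)` — both sides have the same pairing with every `X` (`tauForm_entryT` twice, `tauForm_conjR` twice).
[cite: Balaban1985BackgroundPropagators, (3.32) p.395 (second clause), (3.16) p.393] -/
theorem entryT_conj (hτt : ∀ a b : 𝔸, τ (a * b) = τ (b * a)) (hτp : ∀ a : 𝔸, a ≠ 0 → 0 < (τ (star a * a)).re) {E : 𝔸 → 𝔸}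
    (hEadd : ∀ x y, E (x + y) = E x + E y) (hEsmul : ∀ (c : ℝ) x, E (c • x) = c • E x) {g h : 𝔸ˣ} (hg : g ∈ unitaryUnits 𝔸)
    (hh : h ∈ unitaryUnits 𝔸) (v : 𝔸) :
    entryT τ (fun X => conjR g (E (conjR h⁻¹ X))) (conjR g v) = conjR h (entryT τ E v) := by
  have hN := tauForm_nondegenerate τ hτp
  have hE'add : ∀ x y, (fun X => conjR g (E (conjR h⁻¹ X))) (x + y) =
      (fun X => conjR g (E (conjR h⁻¹ X))) x + (fun X => conjR g (E (conjR h⁻¹ X))) y := fun x y => by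
    simp only [conjR_add, hEadd]
  have hE'smul : ∀ (c : ℝ) x, (fun X => conjR g (E (conjR h⁻¹ X))) (c • x) = c • (fun X => conjR g (E (conjR h⁻¹ X))) x := fun c x => by
    simp only [conjR_smul_real, hEsmul]
  have key : ∀ X, tauForm τ (entryT τ (fun X => conjR g (E (conjR h⁻¹ X))) (conjR g v) - conjR h (entryT τ E v)) X = 0 := by
    intro X
    have h1 : tauForm τ (entryT τ (fun X => conjR g (E (conjR h⁻¹ X))) (conjR g v)) X = tauForm τ v (E (conjR h⁻¹ X)) := by
      rw [tauForm_entryT τ hτp hE'add hE'smul, tauForm_conjR τ hτt hg]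
    have h2 : tauForm τ (conjR h (entryT τ E v)) X = tauForm τ v (E (conjR h⁻¹ X)) := by
      have hX : X = conjR h (conjR h⁻¹ X) := by rw [conjR_conjR, mul_inv_cancel, one_conjR]
      conv_lhs => rw [hX]
      rw [tauForm_conjR τ hτt hh, tauForm_entryT τ hτp hEadd hEsmul]
    rw [map_sub, LinearMap.sub_apply, h1, h2, sub_self]
  exact sub_eq_zero.1 (hN.1 _ key)

end Fibre

/-! ## §2  The class (1.7) is an orbit condition -/

section Regime

variable [Nontrivial 𝔸]

/-- ★ **`Reg17 … (U₀^u) ↔ Reg17 … U₀`** for `u` with `|u|, |u⁻¹| ≤ 1` (every unitary `u`): the plaquette variables conjugate (`plaqF_gaugeAct`) and `R(u(x))`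
is an isometry. [cite: Balaban1985RegularSpaces, (1.7) p.77 (the space 𝔄 is gauge invariant, p.77); Balaban1985Averaging, (8), (11) pp.18–19] -/
theorem reg17_gaugeAct_iff (L m : ℕ) (Ω : ℕ → Set (Site d)) (α : ℝ) {u : Site d → 𝔸ˣ} (hu : ∀ z, u z ∈ U1 𝔸) (U₀ : Site d → Fin d → 𝔸ˣ) :
    Reg17 L m Ω α (gaugeAct u U₀) ↔ Reg17 L m Ω α U₀ := by
  have key : ∀ (x : Site d) (μ ν : Fin d), ‖plaqF (gaugeAct u U₀) μ ν x - 1‖ = ‖plaqF U₀ μ ν x - 1‖ := fun x μ ν => by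
    have h1 : conjR (u x) (plaqF U₀ μ ν x) - 1 = conjR (u x) (plaqF U₀ μ ν x - 1) := by rw [conjR_sub, conjR_one]
    rw [plaqF_gaugeAct, h1, norm_conjR (hu x)]
  unfold Reg17
  simp only [key]

end Regime

/-! ## §3  The single-bond variation, `iη·`, and the class field `𝟙_{Λ_j}(−i)LʲηQ_j(U₀)(iη·)` under `R(u)` -/

section Letters

variable (L : ℕ) (u : Site d → 𝔸ˣ) (U₀ : Site d → Fin d → 𝔸ˣ)

omit [CStarAlgebra 𝔸] in
/-- `R(u)(X·δ_b) = (R(u(b₋))X)·δ_b`. [cite: Balaban1985Averaging, (141) p.39 (bookkeeping)] -/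
theorem bump_conjR {𝔸 : Type*} [NormedRing 𝔸] (u : Site d → 𝔸ˣ) (y : Site d) (μ : Fin d) (X : 𝔸) :
    (fun x κ => conjR (u x) (bump y μ X x κ)) = bump y μ (conjR (u y) X) := by
  funext x κ
  by_cases h : x = y ∧ κ = μ
  · obtain ⟨rfl, rfl⟩ := h
    simp [bump]
  · rw [B7Prop5Flat.bump_eq_zero_of X h, B7Prop5Flat.bump_eq_zero_of _ h, conjR_apply, mul_zero, zero_mul]

omit [CStarAlgebra 𝔸] in
/-- `iη(R(u)A) = R(u)(iηA)`. [cite: Balaban1985RegularSpaces, (1.41) p.83 (bookkeeping)] -/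
theorem iEta_conjR {𝔸 : Type*} [NormedRing 𝔸] [NormedAlgebra ℂ 𝔸] (η : ℝ) (u : Site d → 𝔸ˣ) (A : Site d → Fin d → 𝔸) :
    iEta η (fun z κ => conjR (u z) (A z κ)) = fun z κ => conjR (u z) (iEta η A z κ) := by
  funext z κ
  simp only [iEta, conjR_smul]

/-- ★ **THE CLASS FIELD IS COVARIANT WITH THE LEVEL GAUGE**: `clsField L ΛbP η m j (U₀^u) (R(u)A) (z, κ) = R(u_j(z))·clsField L ΛbP η m j U₀ A (z, κ)`,
`u_j(z) = u(Lʲz)`, for EVERY `u`, EVERY `U₀` (dag-n06-b's `clsField`; `linCovIter_rot`). [cite: Balaban1985BackgroundPropagators, (3.32) p.395, (3.13)–(3.15) p.393; Balaban1985Averaging, (11) p.19] -/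
theorem clsField_gaugeAct (ΛbP : ℕ → ℕ → Set (Site d × Fin d)) (η : ℝ) (m j : ℕ) (A : Site d → Fin d → 𝔸) :
    clsField L ΛbP η m j (gaugeAct u U₀) (fun z κ => conjR (u z) (A z κ)) = fun z κ => conjR (uLev L u j z) (clsField L ΛbP η m j U₀ A z κ) := by
  classical
  funext z κ
  unfold clsField
  by_cases hc : (z, κ) ∈ ΛbP m j
  · rw [if_pos hc, if_pos hc, iEta_conjR, linCovIter_rot, conjR_smul]
  · rw [if_neg hc, if_neg hc, conjR_apply, mul_zero, zero_mul]

end Letters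

/-! ## §4  The transpose `Q_jᵀ` is covariant on class-supported inputs (regime (1.7) at `α_Q`) -/

section Transpose

variable (τ : 𝔸 →ₗ[ℂ] ℂ) [FiniteDimensional ℝ 𝔸] [Nontrivial 𝔸] {L : ℕ}

/-- ★★ **`Q_j(U₀^u)ᵀ(R(u_j)B)(b) = R(u(b₋))·(Q_j(U₀)ᵀB)(b)`** for unitary `U₀` in the class (1.7) at window `α_Q` up to level `m`, unitary `u`, `j ≤ m`, and an
input `B` supported on a bond set `S` each of whose boxes lies in `Ω_j` (so that the columns `X ↦ LʲQ_j(U₀)(X·δ_b)(c)`, `c ∈ S`, are REAL-LINEAR — [5] (122),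
dag-n06-b's `linCovIter_add_of_reg17 ∕ linCovIter_smul_of_reg17`); `τ` tracial faithful.  Term by term: off `S` both entries vanish; on `S` the column map at
`U₀^u` is `R(u_j(c₋))∘(column at U₀)∘R(u(b₋))⁻¹` (`bump_conjR`, `linCovIter_rot`) and `entryT_conj` applies.
[cite: Balaban1985BackgroundPropagators, (3.32) p.395 (second clause), (3.16) p.393; Balaban1985Averaging, (122) p.36, (147) p.40, (11) p.19] -/
theorem linCovIterT_gaugeAct (hL : 2 ≤ L) {m : ℕ} {Ω : ℕ → Set (Site d)} (hτt : ∀ a b : 𝔸, τ (a * b) = τ (b * a))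
    (hτp : ∀ a : 𝔸, a ≠ 0 → 0 < (τ (star a * a)).re) {U₀ : Site d → Fin d → 𝔸ˣ} (hU₀ : ∀ x κ, U₀ x κ ∈ unitaryUnits 𝔸)
    (hreg : Reg17 L m Ω (alphaQ d L) U₀) {u : Site d → 𝔸ˣ} (hu : ∀ z, u z ∈ unitaryUnits 𝔸) {j : ℕ} (hj : j ≤ m)
    (S : Set (Site d × Fin d)) (hbox : ∀ c ∈ S, ∀ x, InBox (loK L j c.1) (bondHiK L j c.1 c.2) x → x ∈ Ω j)
    (B : Site d → Fin d → 𝔸) (hB : ∀ (w : Site d) (κ : Fin d), (w, κ) ∉ S → B w κ = 0) (y : Site d) (μ : Fin d) :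
    linCovIterT τ L (gaugeAct u U₀) j (fun w κ => conjR (uLev L u j w) (B w κ)) y μ = conjR (u y) (linCovIterT τ L U₀ j B y μ) := by
  classical
  have hL1 : 1 ≤ L := le_trans (by norm_num) hL
  unfold linCovIterT
  rw [conjR_sum]
  refine Finset.sum_congr rfl fun κ _ => ?_
  rw [conjR_sum]
  refine Finset.sum_congr rfl fun t _ => ?_
  set w := winBase L j y κ t with hw
  by_cases hc : (w, κ) ∈ S
  · -- the column map at `U₀` is real-linear on the class bond `(w, κ)`
    have hadd : ∀ X X' : 𝔸, linCovIter L U₀ (bump y μ (X + X')) j w κ = linCovIter L U₀ (bump y μ X) j w κ + linCovIter L U₀ (bump y μ X') j w κ := by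
      intro X X'
      have hb : bump y μ (X + X') = bump y μ X + bump y μ X' := by
        funext x κ'
        by_cases h : x = y ∧ κ' = μ
        · obtain ⟨rfl, rfl⟩ := h; simp [bump]
        · simp only [Pi.add_apply, B7Prop5Flat.bump_eq_zero_of _ h, add_zero]
      rw [hb]
      exact linCovIter_add_of_reg17 hL (alphaQ_pos d hL1) le_rfl hU₀ hreg hj w κ (hbox (w, κ) hc) _ _
    have hsmul : ∀ (c : ℝ) (X : 𝔸), linCovIter L U₀ (bump y μ (c • X)) j w κ = c • linCovIter L U₀ (bump y μ X) j w κ := by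
      intro c X
      have hb : bump y μ (c • X) = (c : ℂ) • bump y μ X := by
        funext x κ'
        by_cases h : x = y ∧ κ' = μ
        · obtain ⟨rfl, rfl⟩ := h; simp [bump, Complex.coe_smul]
        · simp only [Pi.smul_apply, B7Prop5Flat.bump_eq_zero_of _ h, smul_zero]
      rw [hb, linCovIter_smul_of_reg17 hL (alphaQ_pos d hL1) le_rfl hU₀ hreg hj w κ (hbox (w, κ) hc), Complex.coe_smul]
    -- the column map at `U₀^u` is the conjugated column map at `U₀`
    have hcol : (fun X => linCovIter L (gaugeAct u U₀) (bump y μ X) j w κ) =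
        fun X => conjR (uLev L u j w) (linCovIter L U₀ (bump y μ (conjR (u y)⁻¹ X)) j w κ) := by
      funext X
      have hb : bump y μ X = fun x κ' => conjR (u x) (bump y μ (conjR (u y)⁻¹ X) x κ') := by
        rw [bump_conjR, conjR_conjR, mul_inv_cancel, one_conjR]
      rw [hb, linCovIter_rot]
    rw [hcol]
    exact entryT_conj τ hτt hτp (E := fun X => linCovIter L U₀ (bump y μ X) j w κ) hadd hsmul (hu _) (hu y) (B w κ)
  · beta_reduce
    rw [hB w κ hc, conjR_apply (uLev L u j w), mul_zero, zero_mul, entryT_zero', entryT_zero', conjR_apply, mul_zero, zero_mul]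

end Transpose

/-! ## §5  ★★★ The genuine `Q*aQ` letter, EDITION P, is gauge covariant -/

section Letter

variable (τ : 𝔸 →ₗ[ℂ] ℂ) [FiniteDimensional ℝ 𝔸] [Nontrivial 𝔸] (L : ℕ)

/-- THE CORE: covariance of `QQZdP` given a domain sequence `Ω` on which the column maps are linear in the regime (class (1.7) at `α_Q` on `Ω` whenever the
letter's own guard holds) and which contains the boxes of the class bonds. [cite: Balaban1985BackgroundPropagators, (3.32) p.395, (3.16) p.393; Balaban1985Averaging, (122) p.36] -/
theorem QQZdP_gaugeAct_core (hL : 2 ≤ L) {ΛbP : ℕ → ℕ → Set (Site d × Fin d)} {i : ZdIdx d L} {m : ℕ} {Ω : ℕ → Set (Site d)}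
    (hbox : ∀ j, j ≤ m → ∀ c ∈ ΛbP m j, ∀ x, InBox (loK L j c.1) (bondHiK L j c.1 c.2) x → x ∈ Ω j)
    (hτt : ∀ a b : 𝔸, τ (a * b) = τ (b * a)) (hτp : ∀ a : 𝔸, a ≠ 0 → 0 < (τ (star a * a)).re)
    {U₀ : Site d → Fin d → 𝔸ˣ} (hU₀ : ∀ x κ, U₀ x κ ∈ unitaryUnits 𝔸) {u : Site d → 𝔸ˣ} (hu : ∀ z, u z ∈ unitaryUnits 𝔸)
    (hlin : Reg17 L m i.Ω (alphaQ d L / (L : ℝ) ^ 2) U₀ → Reg17 L m Ω (alphaQ d L) U₀) (A : Site d → Fin d → 𝔸) :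
    QQZdP τ L ΛbP i m (gaugeAct u U₀) (fun z κ => conjR (u z) (A z κ)) = fun y μ => conjR (u y) (QQZdP τ L ΛbP i m U₀ A y μ) := by
  classical
  have hu1 : ∀ z, u z ∈ U1 𝔸 := fun z => unitaryUnits_le_U1 (hu z)
  funext y μ
  by_cases hreg : Reg17 L m i.Ω (alphaQ d L / (L : ℝ) ^ 2) U₀
  · have hregu : Reg17 L m i.Ω (alphaQ d L / (L : ℝ) ^ 2) (gaugeAct u U₀) := (reg17_gaugeAct_iff L m i.Ω _ hu1 U₀).2 hreg
    rw [QQZdP_of_reg17 τ L hregu, QQZdP_of_reg17 τ L hreg, conjR_sum]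
    refine Finset.sum_congr rfl fun j hjm => ?_
    have hj : j ≤ m := by rw [Finset.mem_range] at hjm; omega
    rw [conjR_smul_real, clsField_gaugeAct]
    congr 1
    refine linCovIterT_gaugeAct τ hL hτt hτp hU₀ (hlin hreg) hu hj (ΛbP m j) (hbox j hj) _ (fun w κ hc => ?_) y μ
    unfold clsField
    rw [if_neg hc]
  · have hregu : ¬ Reg17 L m i.Ω (alphaQ d L / (L : ℝ) ^ 2) (gaugeAct u U₀) := fun h => hreg ((reg17_gaugeAct_iff L m i.Ω _ hu1 U₀).1 h)
    rw [QQZdP_of_not_reg17 τ L hregu, QQZdP_of_not_reg17 τ L hreg, conjR_apply, mul_zero, zero_mul]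

/-- ★★★ **(3.32), SECOND CLAUSE, FOR dag-n06-b's GENUINE LETTER: `(Q*aQ)(U₀^u)(R(u)A) = R(u)((Q*aQ)(U₀)A)`** — `QQZdP τ L ΛbP i m` at a unitary `U₀`, a
unitary gauge function `u`, `2 ≤ L`, under the BOX clause of the averaging class («box of a level-j class bond ⊂ Ω_{j−1}», print's (1.31); the clause of
dag-n06-b's `QQZdP_add`), for EVERY field `A`: ON the class (1.7) (an orbit condition, §2) term by term by §3–§4 with the real weights `w_j`; OFF it both sides
vanish. [cite: Balaban1985BackgroundPropagators, (3.32) p.395, p.396 («the equalities (3.32) hold again»), (3.16) p.393; Balaban1985RegularSpaces, (1.7) p.77, (1.31) p.82; Balaban1985Averaging, (11) p.19, (122) p.36] -/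
theorem QQZdP_gaugeAct (hL : 2 ≤ L) {ΛbP : ℕ → ℕ → Set (Site d × Fin d)} {i : ZdIdx d L} {m : ℕ}
    (hbox : ∀ j, j ≤ m → ∀ c ∈ ΛbP m j, ∀ x, InBox (loK L j c.1) (bondHiK L j c.1 c.2) x → x ∈ i.Ω (j - 1))
    (hτt : ∀ a b : 𝔸, τ (a * b) = τ (b * a)) (hτp : ∀ a : 𝔸, a ≠ 0 → 0 < (τ (star a * a)).re)
    {U₀ : Site d → Fin d → 𝔸ˣ} (hU₀ : ∀ x κ, U₀ x κ ∈ unitaryUnits 𝔸) {u : Site d → 𝔸ˣ} (hu : ∀ z, u z ∈ unitaryUnits 𝔸)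
    (A : Site d → Fin d → 𝔸) :
    QQZdP τ L ΛbP i m (gaugeAct u U₀) (fun z κ => conjR (u z) (A z κ)) = fun y μ => conjR (u y) (QQZdP τ L ΛbP i m U₀ A y μ) := by
  have hL1 : 1 ≤ L := le_trans (by norm_num) hL
  have hL0 : (0 : ℝ) < L := by exact_mod_cast (lt_of_lt_of_le (by norm_num) hL)
  refine QQZdP_gaugeAct_core τ L hL (Ω := fun j => i.Ω (j - 1)) hbox hτt hτp hU₀ hu (fun hreg => ?_) A
  have h := reg17_shift hL1 hreg
  rwa [div_mul_cancel₀ _ (by positivity)] at h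

omit [FiniteDimensional ℝ 𝔸] [Nontrivial 𝔸] in
/-- the class (1.7) on the domain sequence `Ω ≡ ℤᵈ` implies it on every domain sequence. [cite: Balaban1985RegularSpaces, (1.7) p.77 (bookkeeping)] -/
theorem reg17_of_univ {L m : ℕ} {Ω : ℕ → Set (Site d)} {α : ℝ} {U₀ : Site d → Fin d → 𝔸ˣ}
    (h : Reg17 L m (fun _ => (Set.univ : Set (Site d))) α U₀) : Reg17 L m Ω α U₀ :=
  fun j hj x μ ν hμν _ => h j hj x μ ν hμν (Or.inl (Set.mem_univ x))

/-- ★★ **THE SAME WITHOUT THE BOX CLAUSE, for `U₀` in the class (1.7) on ALL of `ℤᵈ`** (window `α_Q∕L²` up to level `m`; dag-n06-w2 g3's regime set for the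
per-member Theorem-3.11 road, containing `U₀ = 1`): every box lies in `ℤᵈ`, so the column maps are linear at every bond.
[cite: Balaban1985BackgroundPropagators, (3.32) p.395, (3.16) p.393; Balaban1985RegularSpaces, (1.7) p.77; Balaban1985Averaging, (122) p.36] -/
theorem QQZdP_gaugeAct_of_reg17Univ (hL : 2 ≤ L) {ΛbP : ℕ → ℕ → Set (Site d × Fin d)} {i : ZdIdx d L} {m : ℕ}
    (hτt : ∀ a b : 𝔸, τ (a * b) = τ (b * a)) (hτp : ∀ a : 𝔸, a ≠ 0 → 0 < (τ (star a * a)).re)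
    {U₀ : Site d → Fin d → 𝔸ˣ} (hU₀ : ∀ x κ, U₀ x κ ∈ unitaryUnits 𝔸)
    (hregU : Reg17 L m (fun _ => (Set.univ : Set (Site d))) (alphaQ d L / (L : ℝ) ^ 2) U₀) {u : Site d → 𝔸ˣ} (hu : ∀ z, u z ∈ unitaryUnits 𝔸)
    (A : Site d → Fin d → 𝔸) :
    QQZdP τ L ΛbP i m (gaugeAct u U₀) (fun z κ => conjR (u z) (A z κ)) = fun y μ => conjR (u y) (QQZdP τ L ΛbP i m U₀ A y μ) := by
  have hL1 : 1 ≤ L := le_trans (by norm_num) hL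
  have hL0 : (0 : ℝ) < L := by exact_mod_cast (lt_of_lt_of_le (by norm_num) hL)
  refine QQZdP_gaugeAct_core τ L hL (Ω := fun _ => (Set.univ : Set (Site d))) (fun _ _ _ _ x _ => Set.mem_univ x) hτt hτp hU₀ hu
    (fun _ => ?_) A
  have h := reg17_shift hL1 hregU
  rwa [div_mul_cancel₀ _ (by positivity)] at h

end Letter

end Literature.MathematicalPhysics.QuantumFieldTheory.Balaban1983to89.B9Eq332AveragingLetterCovarianceZd

end
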